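/-
Copyright (c) 2026 the pub-hodgecm-mathlib formalisation cell (harness21).  Prover seats hodgecm-mathlib-LH4-p10 (g0) (draft v1 4fd3d1c27e575971, §1–§2) and
hodgecm-mathlib-F0P3a-p01 (g31) (§3–§4, filing), req620 Track A «(D-RAM) FOUR-FRAME» squad (unit U3_Laws, MS ROAD A (dealer LH4-plan (g10) WORD #38 (2) ∕ #41 (2));
brick (3c-i) «dualisability exponents» of `F0/P3c/LH4/LH4-p10/g0/MS-ROAD-A-BRICKS.v1.LH4p10g0.md`).  2026-09-03.
-/
import Summits.HodgeConjecture.HodgeConjecture.Theorems.F0P3cDyRamDiagonalHNFDual         -- ★ p855301 (LH4-p14): `dualLatt_diagonal_latt_hnf` (the explicit dual frame `U_D`)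
import Summits.HodgeConjecture.HodgeConjecture.Theorems.F0P3cDyRamLattRowIdeal            -- ★ p855324 (LH4-p14): `v_apply_le_sup_of_mem_latt`, `exists_mem_latt_v_apply_eq_sup` (row ideals of a column lattice)
import Summits.HodgeConjecture.HodgeConjecture.Theorems.F0P3cDyRamDiagonalSelfDualFibre   -- ★ p855307 (LH4-p10): `dualLatt_diagonal_eq_mapGL` (`M^{♯_{d′}} = diag(d∕d′)·M^{♯_d}`), `coe_inv_diagonal`
import Literature.NumberTheory.Automorphic.UnitaryLatticeTreeApartment                  -- ★ `dualLatt_eq_self_of_isSelfDualLattice`, `mem_mapGL_iff`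
import Mathlib.Algebra.Order.GroupWithZero.Finset                                       -- `Finset.sup'_mul₀`
import HarnessLib

/-!
# Crux `H413`, line LH4 «(D-RAM) FOUR-FRAME» road — unit U3_Laws (iii), MS ROAD A brick (3c-i): THE DUALISABILITY EXPONENTS OF A SELF-DUAL LATTICE ARE FORCED
# (if `M` is self-dual for a diagonal form `diag(D)`, then `M^{♯_1} = diag(D)·M`; at a NORMALISED `M` this pins `|D_i| = |pr_i(M^{♯_1})|` — the «`g` forced» step of the (S-fin) oracle)

Cell `hodgecm-mathlib` (D-0151), FLOOR 0, crux item H413 = `stmt-HodgeConjecture-24833`, route of record `HCCMUnconditional`; squad F0∕P3c∕LH4 (req618∕req620).  THEOREMS ONLY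
(no `def`, no instance, no notation, no `sorry`, default heartbeats); lane `--supports stmt-HodgeConjecture-24833 --as helper` (count-neutral).  Target of the road: U3 ED. 4 §S-R
`stub_U3_stableModelSum` (the eight-class model sum (MS)); finite form (S-fin) in `F0/P3c/LH4/LH4-p10/g0/MEMO-stableLaw-finite.v1.LH4p10g0.md` (§2 (3), §3 «Dualisability»).

WHAT IS PROVED (generic valued field `K`, `σ` valuation-preserving, `D_i ≠ 0`; nothing needs `σ(D_i) = D_i` or `|x|,|y|,|z| ≤ 1`).
* §1 `rowSup_eq_of_latt_eq` — two frames of the SAME lattice have the same row maxima: `latt g = latt g′ ⇒ max_j |g_{ij}| = max_j |g′_{ij}|` (★ row-ideal brick both ways: the `i`-th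
  coordinates of `latt g` are bounded by and attain `max_j |g_{ij}|`).
* §2 HEAD (LH4-p10's cut) `rowSup_hnf_eq_rowSup_dual_of_isVertexLattice_zero` — if the HNF lattice `M = latt V`, `V = [[1,0,0],[x,ϖ^b,0],[y,z,ϖ^c]]`, is a type-`0` (self-dual) vertex
  lattice for `diag(D)`, then every row maximum of `V` equals the row maximum of the explicit dual frame `U_D` of ★ p855301 (`M = M^{♯_D} = latt U_D`, then §1).
* §3 THE EXPONENTS IN FRAME CURRENCY: row `i` of `U_D` is `(D_i)⁻¹ ×` row `i` of `U_1 := ((σV)ᵀ)⁻¹` (the dual frame for the STANDARD form `h_1 = Σ σ(x_i) y_i`), so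
  `rowSup_dualOne_eq_mul`: `max_j |(U_1)_{ij}| = |D_i| · max_j |V_{ij}|`, and at a normalised HNF lattice (`max_j |V_{ij}| = 1`) `v_eq_rowSup_dualOne_of_rowSup_eq_one`: `|D_i| = max_j |(U_1)_{ij}|`.
* §4 THE SAME, FRAME-FREE, for ANY lattice `M`: `dualLatt_one_eq_mapGL_of_isVertexLattice_zero_diagonal`: `M^{♯_1} = diag(D)·M` (★ p855307 §1 `M^{♯_1} = diag(D∕1)·M^{♯_D}` and
  `M^{♯_D} = M`); hence `rowIdeal_dualLatt_one_of_isVertexLattice_zero_diagonal`: if `pr_i(M) = 𝒪` (all `|m_i| ≤ 1`, some `|m_i| = 1`) then `pr_i(M^{♯_1}) = D_i·𝒪` — every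
  `w ∈ M^{♯_1}` has `|w_i| ≤ |D_i|`, with equality attained.  So for a NORMALISED lattice the valuation vector of the diagonal forms for which it can be self-dual is FORCED by the lattice
  alone (`|D_i| = |pr_i(M^{♯_1})|`): the «`g` forced, one DVR elimination per lattice» step of the (S-fin) oracle (`explore/finite_engine2.py`) and the parity obstruction «`pr_i(M^{♯_1})`
  must have even exponent» behind the census' dualisability column.  (Brick sheet v1 wrote the relation as `|D_i|·|pr_i((latt V)^{♯_1})| = 1`; from `M^{♯_D} = D⁻¹·M^{♯_1} = M` the
  inversion sits on the other side — sanity check `V = 1`, `D` units.)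
THE MATHEMATICS ([Jacobowitz1962, §4, §7]; [Serre1980Trees, II §1.1]).  Row ideals are lattice invariants; a unimodular (type-`0`) lattice equals its dual; `⟨m, y⟩_1 = ⟨m, D⁻¹y⟩_D`,
so `M^{♯_1} = D·M^{♯_D}`; coordinates scale by `D_i` under `diag(D)`.
HONEST LABEL.  Count-neutral (`--supports`); nothing printed is asserted; (MS) stays a PROVER TARGET; the verdict of record for (D-RAM) stays PRINT [LanglandsShelstad1989 Thm. p. 484 ∕
Rogawski1990 Prop. 4.9.1 (a)] ∕ XL; `HC_CM` is proved only modulo the 7 printed citations (2 remaining named inputs: hLiu418 = `stmt-HodgeConjecture-24832`, h413 =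
`stmt-HodgeConjecture-24833`) until rung 0 closes.

## References
* [Jacobowitz1962] R. Jacobowitz, *Hermitian forms over local fields*, Amer. J. Math. 84 (1962), §4 (duals under a change of form), §7 (unimodular lattices).
* [Serre1980Trees] J.-P. Serre, *Trees* (1980), Ch. II §1.1 (lattices `g·𝒪^N`, invariants of a lattice).
* [Kottwitz1986BaseChangeUnits] R. E. Kottwitz, *Base change for unit elements of Hecke algebras*, Compositio Math. 60 (1986), §1 pp. 240–241 (fixed-lattice counting, normalised representatives).
-/

set_option autoImplicit false

noncomputable section

namespace Summit.HodgeConjecture.HodgeConjecture.Cruxes.H413.F0P3cDyRamDiagonalDualisableExponents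

open Matrix
open Literature.NumberTheory.Automorphic Literature.NumberTheory.Automorphic.HermitianLattice Literature.NumberTheory.Automorphic.UnitaryGroup
open Literature.NumberTheory.Automorphic.UnitaryLatticeTree
open Summit.HodgeConjecture.HodgeConjecture.Cruxes.H413.F0P3cDyRamDiagonalHNFDual
open Summit.HodgeConjecture.HodgeConjecture.Cruxes.H413.F0P3cDyRamLattRowIdeal
open Summit.HodgeConjecture.HodgeConjecture.Cruxes.H413.F0P3cDyRamDiagonalSelfDualFibre
open scoped Valued WithZero Matrix MatrixGroups

variable {K : Type*} [Field K] [Valued K ℤᵐ⁰]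

/-! ## §1  Row maxima are lattice invariants -/

/-- **Two frames of the same lattice have the same row maxima**: `latt g = latt g′ ⇒ max_j |g_{ij}| = max_j |g′_{ij}|` (the `i`-th coordinate ideal of the lattice).
[cite: Serre1980Trees, II §1.1] -/
theorem rowSup_eq_of_latt_eq {g g' : Matrix (Fin 3) (Fin 3) K} (h : latt g = latt g') (i : Fin 3) :
    Finset.univ.sup' Finset.univ_nonempty (fun j => Valued.v (g i j)) = Finset.univ.sup' Finset.univ_nonempty (fun j => Valued.v (g' i j)) := by
  refine le_antisymm ?_ ?_
  · obtain ⟨w, hw, hwi⟩ := exists_mem_latt_v_apply_eq_sup g i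
    rw [← hwi]
    exact v_apply_le_sup_of_mem_latt g' i (h ▸ hw)
  · obtain ⟨w, hw, hwi⟩ := exists_mem_latt_v_apply_eq_sup g' i
    rw [← hwi]
    exact v_apply_le_sup_of_mem_latt g i (h.symm ▸ hw)

/-! ## §2  The head: the row maxima of `V` and of its dual frame `U_D` coincide -/

/-- **«DUALISABILITY EXPONENTS», FRAME FORM (MS ROAD A brick (3c-i); LH4-p10's cut).**  If the HNF lattice `latt V` is a type-`0` vertex lattice of `(K³, diag D)` (`D_i ≠ 0`, `ϖ ≠ 0`,
`σ` valuation-preserving), then every row maximum of `V` equals the corresponding row maximum of the explicit dual frame `U_D` of ★ p855301 — `latt V = (latt V)^♯ = latt U_D` and §1.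
[cite: Jacobowitz1962, §4, §7] [cite: Serre1980Trees, II §1.1] -/
theorem rowSup_hnf_eq_rowSup_dual_of_isVertexLattice_zero {σ : K →+* K} (hvσ : ∀ a, Valued.v (σ a) = Valued.v a) {ϖ : K} (hϖ : ϖ ≠ 0)
    {D : Fin 3 → K} (hD : ∀ i, D i ≠ 0) (x y z : K) (b c : ℕ)
    (hM : IsVertexLattice σ ϖ (Matrix.diagonal D) 0 (latt (!![1, 0, 0; x, ϖ ^ b, 0; y, z, ϖ ^ c] : Matrix (Fin 3) (Fin 3) K))) (i : Fin 3) :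
    Finset.univ.sup' Finset.univ_nonempty (fun j => Valued.v ((!![1, 0, 0; x, ϖ ^ b, 0; y, z, ϖ ^ c] : Matrix (Fin 3) (Fin 3) K) i j)) =
      Finset.univ.sup' Finset.univ_nonempty (fun j => Valued.v
        ((!![(D 0)⁻¹, -σ x * (σ ϖ ^ b)⁻¹ * (D 0)⁻¹, (σ x * σ z * (σ ϖ ^ b)⁻¹ - σ y) * (σ ϖ ^ c)⁻¹ * (D 0)⁻¹;
            0, (σ ϖ ^ b)⁻¹ * (D 1)⁻¹, -σ z * (σ ϖ ^ b)⁻¹ * (σ ϖ ^ c)⁻¹ * (D 1)⁻¹;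
            0, 0, (σ ϖ ^ c)⁻¹ * (D 2)⁻¹] : Matrix (Fin 3) (Fin 3) K) i j)) := by
  have hH : IsUnit (Matrix.diagonal D).det := by
    rw [Matrix.det_diagonal]; exact (Finset.prod_ne_zero_iff.2 fun i _ => hD i).isUnit
  have hself : dualLatt σ (Matrix.diagonal D) (latt (!![1, 0, 0; x, ϖ ^ b, 0; y, z, ϖ ^ c] : Matrix (Fin 3) (Fin 3) K)) =
      latt (!![1, 0, 0; x, ϖ ^ b, 0; y, z, ϖ ^ c] : Matrix (Fin 3) (Fin 3) K) := dualLatt_eq_self_of_isSelfDualLattice hvσ hH hM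
  have hdual := dualLatt_diagonal_latt_hnf σ hvσ hϖ hD x y z b c
  rw [hself] at hdual
  exact rowSup_eq_of_latt_eq hdual i

/-! ## §3  The exponents in frame currency: `max_j |(U_1)_{ij}| = |D_i| · max_j |V_{ij}|` -/

/-- Row `i` of the dual frame `U_D` is `(D_i)⁻¹ ×` row `i` of the dual frame `U_1 = ((σV)ᵀ)⁻¹` for the standard form, valuation-wise. [cite: Jacobowitz1962, §4] -/
theorem v_dualFrame_apply (σ : K →+* K) (ϖ : K) (D : Fin 3 → K) (x y z : K) (b c : ℕ) (i j : Fin 3) :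
    Valued.v ((!![(D 0)⁻¹, -σ x * (σ ϖ ^ b)⁻¹ * (D 0)⁻¹, (σ x * σ z * (σ ϖ ^ b)⁻¹ - σ y) * (σ ϖ ^ c)⁻¹ * (D 0)⁻¹;
          0, (σ ϖ ^ b)⁻¹ * (D 1)⁻¹, -σ z * (σ ϖ ^ b)⁻¹ * (σ ϖ ^ c)⁻¹ * (D 1)⁻¹;
          0, 0, (σ ϖ ^ c)⁻¹ * (D 2)⁻¹] : Matrix (Fin 3) (Fin 3) K) i j) =
      Valued.v ((!![1, -σ x * (σ ϖ ^ b)⁻¹, (σ x * σ z * (σ ϖ ^ b)⁻¹ - σ y) * (σ ϖ ^ c)⁻¹;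
          0, (σ ϖ ^ b)⁻¹, -σ z * (σ ϖ ^ b)⁻¹ * (σ ϖ ^ c)⁻¹;
          0, 0, (σ ϖ ^ c)⁻¹] : Matrix (Fin 3) (Fin 3) K) i j) * (Valued.v (D i))⁻¹ := by
  rw [← map_inv₀, ← map_mul]
  fin_cases i <;> fin_cases j <;> simp

/-- **«DUALISABILITY EXPONENTS», `U_1`-FORM.**  If `latt V` (HNF) is self-dual for `diag(D)`, then for every slot `i`:  `max_j |(U_1)_{ij}| = |D_i| · max_j |V_{ij}|`, where
`U_1 = ((σV)ᵀ)⁻¹` is the dual frame for the standard form (`(latt V)^{♯_1} = latt U_1`, ★ p855301 at `d := 1`) — i.e. `pr_i((latt V)^{♯_1}) = D_i · pr_i(latt V)`.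
[cite: Jacobowitz1962, §4, §7] [cite: Serre1980Trees, II §1.1] -/
theorem rowSup_dualOne_eq_mul {σ : K →+* K} (hvσ : ∀ a, Valued.v (σ a) = Valued.v a) {ϖ : K} (hϖ : ϖ ≠ 0)
    {D : Fin 3 → K} (hD : ∀ i, D i ≠ 0) (x y z : K) (b c : ℕ)
    (hM : IsVertexLattice σ ϖ (Matrix.diagonal D) 0 (latt (!![1, 0, 0; x, ϖ ^ b, 0; y, z, ϖ ^ c] : Matrix (Fin 3) (Fin 3) K))) (i : Fin 3) :
    Finset.univ.sup' Finset.univ_nonempty (fun j => Valued.v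
        ((!![1, -σ x * (σ ϖ ^ b)⁻¹, (σ x * σ z * (σ ϖ ^ b)⁻¹ - σ y) * (σ ϖ ^ c)⁻¹;
            0, (σ ϖ ^ b)⁻¹, -σ z * (σ ϖ ^ b)⁻¹ * (σ ϖ ^ c)⁻¹;
            0, 0, (σ ϖ ^ c)⁻¹] : Matrix (Fin 3) (Fin 3) K) i j)) =
      Valued.v (D i) * Finset.univ.sup' Finset.univ_nonempty (fun j => Valued.v ((!![1, 0, 0; x, ϖ ^ b, 0; y, z, ϖ ^ c] : Matrix (Fin 3) (Fin 3) K) i j)) := by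
  have hDi : Valued.v (D i) ≠ 0 := (Valuation.ne_zero_iff _).2 (hD i)
  have h := rowSup_hnf_eq_rowSup_dual_of_isVertexLattice_zero hvσ hϖ hD x y z b c hM i
  simp_rw [v_dualFrame_apply σ ϖ D x y z b c i] at h
  rw [← Finset.sup'_mul₀ zero_le] at h
  rw [h, mul_comm (Valued.v (D i)), inv_mul_cancel_right₀ hDi]

/-- **«DUALISABILITY EXPONENTS» AT A NORMALISED HNF LATTICE.**  If moreover the `i`-th row maximum of `V` is `1` (`pr_i(latt V) = 𝒪` — every member of `𝓛₀` of (S-fin)), then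
`|D_i| = max_j |(U_1)_{ij}|`: the valuation of the `i`-th entry of ANY diagonal form for which `latt V` is self-dual is READ OFF the dual frame `U_1` — the «`g` forced» step.
[cite: Jacobowitz1962, §4, §7] [cite: Kottwitz1986BaseChangeUnits, §1 pp. 240–241] -/
theorem v_eq_rowSup_dualOne_of_rowSup_eq_one {σ : K →+* K} (hvσ : ∀ a, Valued.v (σ a) = Valued.v a) {ϖ : K} (hϖ : ϖ ≠ 0)
    {D : Fin 3 → K} (hD : ∀ i, D i ≠ 0) (x y z : K) (b c : ℕ)
    (hM : IsVertexLattice σ ϖ (Matrix.diagonal D) 0 (latt (!![1, 0, 0; x, ϖ ^ b, 0; y, z, ϖ ^ c] : Matrix (Fin 3) (Fin 3) K))) (i : Fin 3)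
    (hN : Finset.univ.sup' Finset.univ_nonempty (fun j => Valued.v ((!![1, 0, 0; x, ϖ ^ b, 0; y, z, ϖ ^ c] : Matrix (Fin 3) (Fin 3) K) i j)) = 1) :
    Valued.v (D i) = Finset.univ.sup' Finset.univ_nonempty (fun j => Valued.v
        ((!![1, -σ x * (σ ϖ ^ b)⁻¹, (σ x * σ z * (σ ϖ ^ b)⁻¹ - σ y) * (σ ϖ ^ c)⁻¹;
            0, (σ ϖ ^ b)⁻¹, -σ z * (σ ϖ ^ b)⁻¹ * (σ ϖ ^ c)⁻¹;
            0, 0, (σ ϖ ^ c)⁻¹] : Matrix (Fin 3) (Fin 3) K) i j)) := by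
  rw [rowSup_dualOne_eq_mul hvσ hϖ hD x y z b c hM i, hN, mul_one]

/-! ## §4  The same, frame-free: `M^{♯_1} = diag(D)·M`, so `pr_i(M^{♯_1}) = D_i·pr_i(M)` -/

/-- **`M^{♯_1} = diag(D)·M` FOR A `diag(D)`-SELF-DUAL LATTICE `M`** (any lattice, no frame): ★ p855307 §1 gives `M^{♯_1} = diag(D∕1)·M^{♯_D}`, and `M^{♯_D} = M` (type `0`).
[cite: Jacobowitz1962, §4, §7] -/
theorem dualLatt_one_eq_mapGL_of_isVertexLattice_zero_diagonal {σ : K →+* K} (hvσ : ∀ a, Valued.v (σ a) = Valued.v a) {ϖ : K}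
    {D : Fin 3 → K} (hD : ∀ i, D i ≠ 0) {M : Submodule 𝒪[K] (Fin 3 → K)} (hM : IsVertexLattice σ ϖ (Matrix.diagonal D) 0 M)
    (U : GL (Fin 3) K) (hU : (U : Matrix (Fin 3) (Fin 3) K) = Matrix.diagonal D) :
    dualLatt σ (1 : Matrix (Fin 3) (Fin 3) K) M = mapGL U M := by
  have hH : IsUnit (Matrix.diagonal D).det := by
    rw [Matrix.det_diagonal]; exact (Finset.prod_ne_zero_iff.2 fun i _ => hD i).isUnit
  have hself : dualLatt σ (Matrix.diagonal D) M = M := dualLatt_eq_self_of_isSelfDualLattice hvσ hH hM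
  have hU' : (U : Matrix (Fin 3) (Fin 3) K) = Matrix.diagonal fun i => D i / (fun _ : Fin 3 => (1 : K)) i := by
    rw [hU]; simp only [div_one]
  have h := dualLatt_diagonal_eq_mapGL σ (d := D) (d' := fun _ : Fin 3 => (1 : K)) hD (fun _ => one_ne_zero) M U hU'
  rw [Matrix.diagonal_one, hself] at h
  exact h

/-- **`pr_i(M^{♯_1}) = D_i · 𝒪` AT A NORMALISED SLOT** (frame-free form of the brick).  If `M` is `diag(D)`-self-dual (`D_i ≠ 0`, `σ` valuation-preserving) and its `i`-th coordinate
ideal is exactly `𝒪` (`∀ m ∈ M, |m_i| ≤ 1` and `∃ m ∈ M, |m_i| = 1`), then every `w ∈ M^{♯_1}` has `|w_i| ≤ |D_i|`, with equality attained: `|D_i| = |pr_i(M^{♯_1})|` is FORCED by `M`.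
[cite: Jacobowitz1962, §4, §7] [cite: Kottwitz1986BaseChangeUnits, §1 pp. 240–241] -/
theorem rowIdeal_dualLatt_one_of_isVertexLattice_zero_diagonal {σ : K →+* K} (hvσ : ∀ a, Valued.v (σ a) = Valued.v a) {ϖ : K}
    {D : Fin 3 → K} (hD : ∀ i, D i ≠ 0) {M : Submodule 𝒪[K] (Fin 3 → K)} (hM : IsVertexLattice σ ϖ (Matrix.diagonal D) 0 M) (i : Fin 3)
    (hle : ∀ m ∈ M, Valued.v (m i) ≤ 1) (hex : ∃ m ∈ M, Valued.v (m i) = 1) :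
    (∀ w ∈ dualLatt σ (1 : Matrix (Fin 3) (Fin 3) K) M, Valued.v (w i) ≤ Valued.v (D i)) ∧
      ∃ w ∈ dualLatt σ (1 : Matrix (Fin 3) (Fin 3) K) M, Valued.v (w i) = Valued.v (D i) := by
  have hH : IsUnit (Matrix.diagonal D).det := by
    rw [Matrix.det_diagonal]; exact (Finset.prod_ne_zero_iff.2 fun i _ => hD i).isUnit
  set U : GL (Fin 3) K := Matrix.nonsingInvUnit (Matrix.diagonal D) hH with hU_def
  have hU : (U : Matrix (Fin 3) (Fin 3) K) = Matrix.diagonal D := rfl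
  have hdual := dualLatt_one_eq_mapGL_of_isVertexLattice_zero_diagonal hvσ hD hM U hU
  have hUinv := coe_inv_diagonal hD U hU
  refine ⟨fun w hw => ?_, ?_⟩
  · rw [hdual, mem_mapGL_iff, hUinv] at hw
    have hm := hle _ hw
    rw [Matrix.mulVec_diagonal, map_mul, map_inv₀] at hm
    have hDi : Valued.v (D i) ≠ 0 := (Valuation.ne_zero_iff _).2 (hD i)
    calc Valued.v (w i) = Valued.v (D i) * ((Valued.v (D i))⁻¹ * Valued.v (w i)) := by rw [← mul_assoc, mul_inv_cancel₀ hDi, one_mul]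
      _ ≤ Valued.v (D i) * 1 := by gcongr
      _ = Valued.v (D i) := mul_one _
  · obtain ⟨m, hm, hmi⟩ := hex
    refine ⟨(U : Matrix (Fin 3) (Fin 3) K).mulVec m, ?_, ?_⟩
    · rw [hdual]
      exact Submodule.mem_map.2 ⟨m, hm, by rw [LinearMap.restrictScalars_apply, Matrix.toLin'_apply]⟩
    · rw [hU, Matrix.mulVec_diagonal, map_mul, hmi, mul_one]

end Summit.HodgeConjecture.HodgeConjecture.Cruxes.H413.F0P3cDyRamDiagonalDualisableExponents

end
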